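import Summits.BirchSwinnertonDyer.Rank1Residual.Additive.BudgetFromTamagawaCertificatesEnds
import Summits.BirchSwinnertonDyer.Rank1Residual.Additive.BudgetFromTamagawaCertificatesLayerNoTate
import HarnessLib

/-!
# The four rank-0 class ENDs at `p = 3` fed with the level-`n` certificate budget — WITHOUT Tate's
# uniformisation and WITHOUT the reduction-type hypothesis (cell `b2b-bsdres`, team n1011, seat
# p01 GEN 4; row T-L1-KN2, second addendum: the `hU`/`hdat`-free twins of n1011-p16's T-BUDn-END
# file `BudgetFromTamagawaCertificatesEnds.lean`, one author per file)

HONEST FRAMING (cell `b2b-bsdres`, run/shared/lean/b2b/bsd-rank1-residual/, verbatim in every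
file): the goal of the cell is to DELETE the COMBINATION-SHAPED residual classes of the
Birch–Swinnerton-Dyer formula for ALL analytic-rank `≤ 1` elliptic curves over `ℚ` — "full BSD
formula for every rank `≤ 1` curve in class `C`" assembled STRICTLY from published theorems — so
that the rank-`≤ 1` remainder becomes exactly the CONSTRUCTION-SHAPED classes, which are TYPED
(missing-input `Prop`s), NOT attempted. This is not "finishing BSD". Team n1011 (N10 / N11, the
Route-G budget node): research route; no claim beyond the stated classes; X3 / X4 stay
CONSTRUCTION-SHAPED; nothing is booked; marks UNCHANGED; NOT a yield claim. Theorems only: no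
definition, no named fact, no `sorry`; census certificates enter as HYPOTHESES per row.

## What

n1011-p16's `BudgetFromTamagawaCertificatesEnds.lean` (row T-BUDn-END) feeds the four rank-0 class
ENDs at `p = 3` — `ClassX4Gord.…_of_coeffCert_of_tamagawaCertificates_of_nonAnomalous`,
`ClassX4M.…_of_firstUnitIndex_of_tamagawaCertificates`, `ClassX3Gord.…`, `ClassX3M.…` — with
n1011-p10's MAIN `budgetLeLambdaAt_layer_of_certificates`, hence carries `hU` (Tate's uniformisation,
named fact A40) and the per-row reduction-type literal `hdat`. Row T-L1-KN2 (this seat) proved the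
split-multiplicative Tamagawa witness WITHOUT Tate (`SplitMultiplicativeWitnessKodairaNeron*`) and
showed that for odd `p` the census datum `p ∣ c_v` already forces additive or split multiplicative
reduction (`BudgetFromTamagawaCertificatesLayerNoTate` §2), giving the MAIN
`budgetLeLambdaAt_layer_of_certificates_of_dvd` from the THREE census columns `v ∤ p`,
`v_p(N(v)^{p−1} − 1) = m_v + 1`, `p ∣ c_v`. This file is p16's four ENDs re-fed with that MAIN —
the SAME conclusions `BSDp W 3` with `hU` AND `hdat` DELETED from the signatures:

* `ClassX4Gord.bsdp_three_rankZero_of_katoHalf_of_coeffCert_of_tamagawaDvd_of_nonAnomalous`,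
* `ClassX4M.bsdp_three_rankZero_of_surj_of_katoHalf_of_firstUnitIndex_of_tamagawaDvd`,
* `ClassX3Gord.bsdp_three_rankZero_of_wuthrichHalf_of_coeffCert_of_tamagawaDvd_of_nonAnomalous`,
* `ClassX3M.bsdp_three_rankZero_of_wuthrichHalf_of_firstUnitIndex_of_tamagawaDvd`.

Binders after composition: the parents' named facts (Kato 17.4 (3) half / Wuthrich Thm. 16 half,
Delbourgo 1998 Prop. 4, Delbourgo 2002 at 3, Pal where the parent keeps it, GZK, modularity) +
{`h414`, `hPT`, `hEP`} — A40 GONE — + the per-row census LITERALS (`hval`, `hcv`, `hcert` / `hrec`,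
`hna`, `hcm`, `htors` on X3) — EVIDENCE when instantiated; nothing is instantiated here; p16's forms
stay as dominated twins. HONEST LIMITS as in p16's file: closes no class; one budget inequality per
layer; literals per row.

References: R. Greenberg, LNM 1716 (1999) §3 p. 74, §5 and Prop. 4.14; K. Kato, Astérisque 295
Thm. 17.4; C. Wuthrich (2014) Thm. 16; D. Delbourgo 1998 Prop. 4, 2002 Thm. (A)/(B); J. H.
Silverman, *ATAEC* Cor. IV.9.2 (d), IV.9.4 Step 2; R. L. Miller 2011 Def. 1.1.
-/

set_option autoImplicit false

noncomputable section

open scoped Classical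

open WeierstrassCurve NumberField IsDedekindDomain Literature.NumberTheory.EllipticCurves
  Literature.NumberTheory.EllipticCurves.ModularForms
  Literature.NumberTheory.EllipticCurves.Rank1Residual
  Literature.NumberTheory.EllipticCurves.Rank1Residual.Typed
  Literature.NumberTheory.EllipticCurves.Delbourgo2002
  Literature.NumberTheory.GaloisRepresentations
  Literature.NumberTheory.GaloisCohomology
  Summit.BirchSwinnertonDyer.Rank1Residual.Iwasawa
  Summit.BirchSwinnertonDyer.Rank1Residual.Additive
  Summit.BirchSwinnertonDyer.Rank1Residual.Additive.CensusQ6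
  Summit.BirchSwinnertonDyer.Rank1Residual.AdditivePotMult

/-! ## §1 The X4 ENDs (N11): `3 ∤ #E(ℚ)_tors` from `Surj` -/

namespace Summit.BirchSwinnertonDyer.Rank1Residual.Additive

/-- **X4♯(G-ord)@3 ∧ surj(3), `r_an = 0`, non-CM, non-anomalous: `BSD(E,3)` ⟸ ONE 3-adic unit
coefficient at index `b = Σ_{v ∈ S} 3^{min(n, m_v)}` + the level-`n` certificate budget on `S` read
off the THREE census columns** (each `v ∈ S`: `v ∤ 3`, place count `hval`, `3 ∣ c_v`) — n1011-p16's
`…_of_coeffCert_of_tamagawaCertificates_of_nonAnomalous` with `hU` (A40) and `hdat` DELETED, via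
`budgetLeLambdaAt_layer_of_certificates_of_dvd`. Named facts: Kato's half `hK`, Delbourgo 1998
Prop. 4, Delbourgo 2002 at 3, GZK, modularity, Greenberg 4.14, PT over `ℚ_n`, EP at the places of
`ℚ_n` — no A40. Closes no class; literals per row.
[cite: GreenbergLNM1716, §5 pp. 114–118 and Prop. 4.14] [cite: Kato2004Asterisque, Thm. 17.4 (3) (p. 273)]
[cite: Delbourgo2002, Theorem (A), (B) (p. 40), Hypothesis (p. 39)] [cite: SilvermanATAEC1994, Cor. IV.9.2(d) (PDF p. 340), IV.9.4 Step 2 (PDF p. 344)] -/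
theorem ClassX4Gord.bsdp_three_rankZero_of_katoHalf_of_coeffCert_of_tamagawaDvd_of_nonAnomalous
    [Fact (Nat.Prime 3)] {W : WeierstrassCurve ℚ} [W.IsElliptic] [W.IsGloballyMinimal]
    (hK : Wuthrich2014.kato_halfEigenCharIdeal_dvd_cyclotomicPrime_of_surjective)
    (hDel98 : Delbourgo1998.prop4_rankZero_pow_dvd_constantCoeff)
    (hDel3 : Delbourgo2002.mainTheorem_three)
    (hGZK : rank_eq_analyticRank_of_analyticRank_le_one) (hmod : hasEntireLFunction_rat)
    (hmodD : nonempty_modularParametrizationData)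
    (h414 : Greenberg1999.prop414_noFiniteSubmodule_of_not_dvd_torsionOrder) (n : ℕ)
    (hPT : ∀ (κ : ZpExtension ℚ 3) [NumberField (κ.layer n)], κ.IsCyclotomic →
      poitouTate_selmerStructure_duality (κ.layer n))
    (hEP : ∀ (κ : ZpExtension ℚ 3) [NumberField (κ.layer n)], κ.IsCyclotomic →
      ∀ w : HeightOneSpectrum (𝓞 (κ.layer n)),
      localEulerPoincareCharacteristic (w.adicCompletion (κ.layer n)))
    (hX : ClassX4Gord W 3) (hcm : ¬ W.HasCM) (hsurj : Surj W 3) (hr : W.analyticRank = 0)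
    (S : Finset (HeightOneSpectrum (𝓞 ℚ))) (m : HeightOneSpectrum (𝓞 ℚ) → ℕ)
    (hSp : ∀ v ∈ S, ((3 : ℕ) : 𝓞 ℚ) ∉ v.asIdeal)
    (hval : ∀ v ∈ S, padicValNat 3 (v.residueCard ^ (3 - 1) - 1) = m v + 1)
    (hcv : ∀ v ∈ S,
      3 ∣ (W.baseChange (v.adicCompletion ℚ)).localTamagawaNumber (v.adicCompletionIntegers ℚ))
    (hcert : BranchUnitCoeffAt W 3 (∑ v ∈ S, 3 ^ min n (m v)))
    (hna : ReductionNonAnomalous W 3) : BSDp W 3 :=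
  ClassX4Gord.bsdp_three_rankZero_of_katoHalf_of_coeffCert_of_budget_of_nonAnomalous_noPal hK hDel98
    hDel3 hGZK hmod hmodD hX hcm hsurj hr hcert
    (budgetLeLambdaAt_layer_of_certificates_of_dvd (by decide) h414
      (not_dvd_torsionOrder_of_surj 3 W hsurj) n hPT hEP S m hSp hval hcv) hna

end Summit.BirchSwinnertonDyer.Rank1Residual.Additive

namespace Summit.BirchSwinnertonDyer.Rank1Residual.AdditivePotMult

open Summit.BirchSwinnertonDyer.Rank1Residual.Additive

/-- **X4(M)@3 ∧ surj(3), `r_an = 0`: `BSD(E,3)` ⟸ the odd first-unit-index record at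
`b = Σ_{v ∈ S} 3^{min(n, m_v)}` + the level-`n` certificate budget on `S` read off the THREE census
columns** — n1011-p16's `…_of_firstUnitIndex_of_tamagawaCertificates` with `hU` and `hdat` DELETED
(p07's `…_of_firstUnitIndex_of_budget` with `hbud := budgetLeLambdaAt_layer_of_certificates_of_dvd …`).
Named facts: Kato's half, Delbourgo 1998 Prop. 4 (+ the (M) reading `hDelX`), Pal (kept by the parent's
parity-uniform chain, idle at 3), GZK, modularity, Greenberg 4.14, PT, EP — no A40. Closes no class.
[cite: GreenbergLNM1716, §5 pp. 114–118 and Prop. 4.14] [cite: Kato2004Asterisque, Thm. 17.4 (3) (p. 273)]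
[cite: Delbourgo1998, Prop. 4 (p. 144)] [cite: SilvermanATAEC1994, Cor. IV.9.2(d) (PDF p. 340), IV.9.4 Step 2 (PDF p. 344)] -/
theorem ClassX4M.bsdp_three_rankZero_of_surj_of_katoHalf_of_firstUnitIndex_of_tamagawaDvd
    [Fact (Nat.Prime 3)] {W : WeierstrassCurve ℚ} [W.IsElliptic] [W.IsGloballyMinimal]
    (hK : Wuthrich2014.kato_halfEigenCharIdeal_dvd_cyclotomicPrime_of_surjective)
    (hDel : Delbourgo1998.prop4_rankZero_pow_dvd_constantCoeff)
    (hDelX : Delbourgo1998.prop4_rankZero_constantCoeff_eq_unit_mul_of_potMult)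
    (hPal : Pal2012.thm32_sqrt_mul_realPeriodRat_twist_eq_of_prime_one_mod_four)
    (hGZK : rank_eq_analyticRank_of_analyticRank_le_one) (hmod : hasEntireLFunction_rat)
    (hmodD : nonempty_modularParametrizationData)
    (h414 : Greenberg1999.prop414_noFiniteSubmodule_of_not_dvd_torsionOrder) (n : ℕ)
    (hPT : ∀ (κ : ZpExtension ℚ 3) [NumberField (κ.layer n)], κ.IsCyclotomic →
      poitouTate_selmerStructure_duality (κ.layer n))
    (hEP : ∀ (κ : ZpExtension ℚ 3) [NumberField (κ.layer n)], κ.IsCyclotomic →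
      ∀ w : HeightOneSpectrum (𝓞 (κ.layer n)),
      localEulerPoincareCharacteristic (w.adicCompletion (κ.layer n)))
    (hX : ClassX4M W 3) (hsurj : Surj W 3) (hr : W.analyticRank = 0)
    (S : Finset (HeightOneSpectrum (𝓞 ℚ))) (m : HeightOneSpectrum (𝓞 ℚ) → ℕ)
    (hSp : ∀ v ∈ S, ((3 : ℕ) : 𝓞 ℚ) ∉ v.asIdeal)
    (hval : ∀ v ∈ S, padicValNat 3 (v.residueCard ^ (3 - 1) - 1) = m v + 1)
    (hcv : ∀ v ∈ S,
      3 ∣ (W.baseChange (v.adicCompletion ℚ)).localTamagawaNumber (v.adicCompletionIntegers ℚ))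
    (hrec : MultOddFirstUnitIndexAt W 3 (∑ v ∈ S, 3 ^ min n (m v))) : BSDp W 3 :=
  hX.bsdp_three_rankZero_of_surj_of_katoHalf_of_firstUnitIndex_of_budget hK hDel hDelX hPal hGZK hmod
    hmodD hsurj hr hrec
    (budgetLeLambdaAt_layer_of_certificates_of_dvd (by decide) h414
      (not_dvd_torsionOrder_of_surj 3 W hsurj) n hPT hEP S m hSp hval hcv)

end Summit.BirchSwinnertonDyer.Rank1Residual.AdditivePotMult

/-! ## §2 The X3♯ ENDs (N10): `E[3]` reducible, `htors : 3 ∤ #E(ℚ)_tors` an explicit census bit -/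

namespace Summit.BirchSwinnertonDyer.Rank1Residual.Additive

/-- **X3♯(G-ord)@3, `r_an = 0`, non-CM, non-anomalous, `3 ∤ #E(ℚ)_tors`: `BSD(E,3)` ⟸ ONE 3-adic
unit coefficient at index `b = Σ_{v ∈ S} 3^{min(n, m_v)}` + the level-`n` certificate budget on `S`
read off the THREE census columns** — n1011-p16's
`…_of_wuthrichHalf_of_coeffCert_of_tamagawaCertificates_of_nonAnomalous` with `hU` and `hdat`
DELETED; NO image hypothesis (Wuthrich's Thm. 16 half); `htors` is a census bit on these reducible
rows. Named facts: Wuthrich Thm. 16, Delbourgo 1998 Prop. 4, Delbourgo 2002 at 3, GZK, modularity,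
Greenberg 4.14, PT, EP — no A40. Closes no class; literals per row.
[cite: GreenbergLNM1716, §5 pp. 114–118 and Prop. 4.14] [cite: Wuthrich2014, Thm. 16 (p. 397)]
[cite: Delbourgo2002, Theorem (A), (B) (p. 40), Hypothesis (p. 39)] [cite: SilvermanATAEC1994, Cor. IV.9.2(d) (PDF p. 340), IV.9.4 Step 2 (PDF p. 344)] -/
theorem ClassX3Gord.bsdp_three_rankZero_of_wuthrichHalf_of_coeffCert_of_tamagawaDvd_of_nonAnomalous
    [Fact (Nat.Prime 3)] {W : WeierstrassCurve ℚ} [W.IsElliptic] [W.IsGloballyMinimal]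
    (hWu : Wuthrich2014.thm16_halfEigenCharIdeal_dvd_cyclotomicPrime)
    (hDel98 : Delbourgo1998.prop4_rankZero_pow_dvd_constantCoeff)
    (hDel3 : Delbourgo2002.mainTheorem_three)
    (hGZK : rank_eq_analyticRank_of_analyticRank_le_one) (hmod : hasEntireLFunction_rat)
    (hmodD : nonempty_modularParametrizationData)
    (h414 : Greenberg1999.prop414_noFiniteSubmodule_of_not_dvd_torsionOrder) (n : ℕ)
    (hPT : ∀ (κ : ZpExtension ℚ 3) [NumberField (κ.layer n)], κ.IsCyclotomic →
      poitouTate_selmerStructure_duality (κ.layer n))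
    (hEP : ∀ (κ : ZpExtension ℚ 3) [NumberField (κ.layer n)], κ.IsCyclotomic →
      ∀ w : HeightOneSpectrum (𝓞 (κ.layer n)),
      localEulerPoincareCharacteristic (w.adicCompletion (κ.layer n)))
    (hX : ClassX3Gord W 3) (hcm : ¬ W.HasCM) (htors : ¬ 3 ∣ W.torsionOrder) (hr : W.analyticRank = 0)
    (S : Finset (HeightOneSpectrum (𝓞 ℚ))) (m : HeightOneSpectrum (𝓞 ℚ) → ℕ)
    (hSp : ∀ v ∈ S, ((3 : ℕ) : 𝓞 ℚ) ∉ v.asIdeal)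
    (hval : ∀ v ∈ S, padicValNat 3 (v.residueCard ^ (3 - 1) - 1) = m v + 1)
    (hcv : ∀ v ∈ S,
      3 ∣ (W.baseChange (v.adicCompletion ℚ)).localTamagawaNumber (v.adicCompletionIntegers ℚ))
    (hcert : BranchUnitCoeffAt W 3 (∑ v ∈ S, 3 ^ min n (m v)))
    (hna : ReductionNonAnomalous W 3) : BSDp W 3 :=
  ClassX3Gord.bsdp_three_rankZero_of_wuthrichHalf_of_coeffCert_of_budget_of_nonAnomalous hWu hDel98 hDel3
    hGZK hmod hmodD hX hcm hr hcert
    (budgetLeLambdaAt_layer_of_certificates_of_dvd (by decide) h414 htors n hPT hEP S m hSp hval hcv)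
    hna

end Summit.BirchSwinnertonDyer.Rank1Residual.Additive

namespace Summit.BirchSwinnertonDyer.Rank1Residual.AdditivePotMult

open Summit.BirchSwinnertonDyer.Rank1Residual.Additive

/-- **X3♯(M)@3, `r_an = 0`, `3 ∤ #E(ℚ)_tors`: `BSD(E,3)` ⟸ the odd first-unit-index record at
`b = Σ_{v ∈ S} 3^{min(n, m_v)}` + the level-`n` certificate budget on `S` read off the THREE census
columns** — n1011-p16's `ClassX3M.…_of_wuthrichHalf_of_firstUnitIndex_of_tamagawaCertificates` with
`hU` and `hdat` DELETED; NO image hypothesis, NO Pal; `htors` a census bit. Named facts: Wuthrich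
Thm. 16, Delbourgo 1998 Prop. 4 (+ `hDelX`), GZK, modularity, Greenberg 4.14, PT, EP — no A40.
Closes no class; literals per row.
[cite: GreenbergLNM1716, §5 pp. 114–118 and Prop. 4.14] [cite: Wuthrich2014, Thm. 16 (p. 397)]
[cite: Delbourgo1998, Prop. 4 (p. 144)] [cite: SilvermanATAEC1994, Cor. IV.9.2(d) (PDF p. 340), IV.9.4 Step 2 (PDF p. 344)] -/
theorem ClassX3M.bsdp_three_rankZero_of_wuthrichHalf_of_firstUnitIndex_of_tamagawaDvd
    [Fact (Nat.Prime 3)] {W : WeierstrassCurve ℚ} [W.IsElliptic] [W.IsGloballyMinimal]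
    (hW16 : Wuthrich2014.thm16_halfEigenCharIdeal_dvd_cyclotomicPrime)
    (hDel : Delbourgo1998.prop4_rankZero_pow_dvd_constantCoeff)
    (hDelX : Delbourgo1998.prop4_rankZero_constantCoeff_eq_unit_mul_of_potMult)
    (hGZK : rank_eq_analyticRank_of_analyticRank_le_one) (hmod : hasEntireLFunction_rat)
    (hmodD : nonempty_modularParametrizationData)
    (h414 : Greenberg1999.prop414_noFiniteSubmodule_of_not_dvd_torsionOrder) (n : ℕ)
    (hPT : ∀ (κ : ZpExtension ℚ 3) [NumberField (κ.layer n)], κ.IsCyclotomic →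
      poitouTate_selmerStructure_duality (κ.layer n))
    (hEP : ∀ (κ : ZpExtension ℚ 3) [NumberField (κ.layer n)], κ.IsCyclotomic →
      ∀ w : HeightOneSpectrum (𝓞 (κ.layer n)),
      localEulerPoincareCharacteristic (w.adicCompletion (κ.layer n)))
    (hX : ClassX3M W 3) (htors : ¬ 3 ∣ W.torsionOrder) (hr : W.analyticRank = 0)
    (S : Finset (HeightOneSpectrum (𝓞 ℚ))) (m : HeightOneSpectrum (𝓞 ℚ) → ℕ)
    (hSp : ∀ v ∈ S, ((3 : ℕ) : 𝓞 ℚ) ∉ v.asIdeal)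
    (hval : ∀ v ∈ S, padicValNat 3 (v.residueCard ^ (3 - 1) - 1) = m v + 1)
    (hcv : ∀ v ∈ S,
      3 ∣ (W.baseChange (v.adicCompletion ℚ)).localTamagawaNumber (v.adicCompletionIntegers ℚ))
    (hrec : MultOddFirstUnitIndexAt W 3 (∑ v ∈ S, 3 ^ min n (m v))) : BSDp W 3 :=
  hX.bsdp_three_rankZero_of_wuthrichHalf_of_firstUnitIndex_of_budget hW16 hDel hDelX hGZK hmod hmodD hr
    hrec
    (budgetLeLambdaAt_layer_of_certificates_of_dvd (by decide) h414 htors n hPT hEP S m hSp hval hcv)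

end Summit.BirchSwinnertonDyer.Rank1Residual.AdditivePotMult

end
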